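/-
Copyright (c) 2026 the pub-hodgecm-mathlib formalisation cell (harness21).  Prover seat hodgecm-mathlib-LH4-p12 (g7), req620 Track A «(D-RAM) FOUR-FRAME», line LH4
(STAGE-1b tier-0 regular row, (L-sq) labelled trunk brick (d) PART 3: the apex-3 glued cell G3 and the core-hanging cell H of the labelled trunk IN THE CURRENCY OF
`SqLabelledBoxSum` — the two families the ★ p859787 rotations cannot serve from G1 (the `(0 2)`-rescaling does not preserve the square token; H is its own family)).  2026-09-04.
-/
import Summits.HodgeConjecture.HodgeConjecture.Theorems.F0P3cDyRamSqLabelledCellsGlued          -- (d) PART 2 (this seat): emptiness off the windows, letters, G1∕G2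
import Summits.HodgeConjecture.HodgeConjecture.Theorems.F0P3cDyRamLabelledKappaSqTokenCells      -- ★ p859864 (LH4-p09 (g8)) K6: the equilateral H foot at the square token
import HarnessLib

/-!
# Crux `H413`, line LH4 «(D-RAM) FOUR-FRAME» — (d) PART 3: THE CELLS G3 AND H OF THE SQUARE LABEL IN BOX-SUM CURRENCY

Square label of record `Q = LatticeInLevel ϖ ℓ (diag((α−1)², (β−1)², 0))`, `ℓ + 1 = d % 2 + 2d`, fence `2d ≤ nᵢ + 1`.

* §1 `sqLabel_G3_cond_of`, `le_of_sqLabel_G3_cond`, `sqLabel_H_cond_of` — the rotated ∕ core-hanging label conditions from ∕ to exponent inequalities;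
  `stratum_H_eq_empty_of_no_window`, `cell_H_of_no_window` (★ stable socket `finsum_stabiliserWeight_hasAxis_H` + PART 2's positivity).
* §2 `cell_G3` — ★ p856906's `hG3` value (its `n₁`-based spelling) with the glue-foot summand cut by `2ρ + (d%2 + 2d) ≤ 2n₁ + 1`: windows ⇒ ★ p859941 `…G3…_of_not_cut` (the
  class cut is excluded by the token letters: in a tube `2n₂ ≥ ℓ + 2ρ`; on a foot the datum is of type `n₁ = n₂ < n₃` and the third letter is STRICTLY deeper than `2n₂ + s`,
  ★ `sqToken_third_le_typeC`); no window ⇒ EMPTY (PART 2, rotated).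
* §3 `cell_H` — ★ p856906's `hH` value cut by `2ρ + (d%2 + 2d) ≤ 2n₁ + 1`: tube window ⇒ vacuous and κ-null (★ NotCut H); equilateral foot ⇒ ★ p859864
  `…_H_sep_sqToken_foot` (`[reads]·[ℓ + 2ρ ≤ 2n]·★κH` — the cut hanging cells are EMPTY, LH4-p09's disjoint balls); no window ⇒ EMPTY stratum.

HONEST LABEL: helper lane (`--supports stmt-HodgeConjecture-24833`), count-neutral; per-stratum census identities; pays no tier-0 row (T₊∕T₋∕reg OPEN; labelled trunk OPEN =
(c) `SqLabelledBoxSum_holds` (LH4-p10) + (d) PART 4 assembly); HC_CM is proved only modulo the 7 printed citations (2 remaining named inputs: hLiu418 =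
stmt-HodgeConjecture-24832, h413 = stmt-HodgeConjecture-24833) until rung 0 closes.

## References (NEVER `[KR2]`)
* [Kottwitz1986BaseChangeUnits] R. E. Kottwitz, *Base change for unit elements of Hecke algebras*, Compositio Math. 60 (1986), §1 pp. 240–241.
* [Rogawski1990] J. D. Rogawski, *Automorphic Representations of Unitary Groups in Three Variables*, Ann. of Math. Stud. 123 (1990), §4.9 Prop. 4.9.1 (a) p. 55, §4.10 p. 58.
* [LanglandsShelstad1987] R. P. Langlands, D. Shelstad, *On the definition of transfer factors*, Math. Ann. 278 (1987), §3.
-/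

set_option autoImplicit false

noncomputable section

namespace Summit.HodgeConjecture.HodgeConjecture.Cruxes.H413.F0P3cDyRamSqLabelledCellsCorner

open Matrix
open Literature.NumberTheory.Automorphic Literature.NumberTheory.Automorphic.HermitianLattice
open Literature.NumberTheory.Automorphic.UnitaryLatticeTree Literature.NumberTheory.Automorphic.UnitaryThreeFourFrame
open Literature.NumberTheory.LocalFields Literature.NumberTheory.LocalFields.WildQuadraticDatum
open Summit.HodgeConjecture.HodgeConjecture.Cruxes.H413.F0P3cDyRamDiagonalTorusDefs
open Summit.HodgeConjecture.HodgeConjecture.Cruxes.H413.F0P3cDyRamDiagonalStrataDefs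
open Summit.HodgeConjecture.HodgeConjecture.Cruxes.H413.F0P3cDyRamDiagonalKappaCountDefs
open Summit.HodgeConjecture.HodgeConjecture.Cruxes.H413.F0P3cDyRamDiagonalCoreHangingSocket (finsum_stabiliserWeight_hasAxis_H)
open Summit.HodgeConjecture.HodgeConjecture.Cruxes.H413.F0P3cDyRamElementDatumParity (isoceles_of_isElementDatum depth_mod_two_eq_of_isElementDatum)
open Summit.HodgeConjecture.HodgeConjecture.Cruxes.H413.F0P3cDyRamFourFrameCensusDefs
open Summit.HodgeConjecture.HodgeConjecture.Cruxes.H413.F0P3cDyRamSqDatumDerivedFence (lt_of_pow_lt_pow)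
open Summit.HodgeConjecture.HodgeConjecture.Cruxes.H413.F0P3cDyRamLabelledKappaGluedSocketsNotCut
open Summit.HodgeConjecture.HodgeConjecture.Cruxes.H413.F0P3cDyRamLabelledKappaSqTokenCells (finsum_kappaCount_mul_stabiliserWeight_stratum_H_sep_sqToken_foot)
open Summit.HodgeConjecture.HodgeConjecture.Cruxes.H413.F0P3cDyRamSqLabelledCellsSplit
open Summit.HodgeConjecture.HodgeConjecture.Cruxes.H413.F0P3cDyRamSqLabelledCellsGlued
open scoped Valued WithZero Matrix MatrixGroups

variable {K : Type} [Field K] [Valued K ℤᵐ⁰] [Fintype 𝓀[K]] [CompleteSpace K] {σ : K →+* K} {ϖ : K} {d t : ℕ} {α β : K} {N₀ n₁ n₂ n₃ : ℕ}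
  {T : GL (Fin 3) K}

/-! ## §1  Label conditions G3 ∕ H from exponents; the empty H strata -/

omit [Fintype 𝓀[K]] [CompleteSpace K] in
/-- **THE (ROTATED) G3 LABEL CONDITION FROM EXPONENT INEQUALITIES** (square-token letters; `X` an exponent with `|E₁ − E₀| ≤ |ϖ|^X`). [cite: Kottwitz1986BaseChangeUnits, §1 pp. 240–241] -/
theorem sqLabel_G3_cond_of {ϖ : K} (hϖ1 : Valued.v ϖ ≤ 1) {E : Fin 3 → K} {n₁ n₂ X ℓ ρ s : ℕ}
    (he0 : Valued.v (E 0) = Valued.v ϖ ^ (2 * n₂)) (he1 : Valued.v (E 1) = Valued.v ϖ ^ (2 * n₁)) (he2 : E 2 = 0)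
    (he10 : Valued.v (E 1 - E 0) ≤ Valued.v ϖ ^ X)
    (h0 : ℓ ≤ 2 * n₂) (h1 : ℓ ≤ 2 * n₁) (h12 : ℓ + ρ ≤ 2 * n₁) (h10 : ℓ + ρ + s ≤ X) (hc1 : ℓ + 2 * ρ + s ≤ X) (hc2 : ℓ + 2 * ρ ≤ 2 * n₂) :
    (Valued.v (E 2) ≤ Valued.v ϖ ^ ℓ ∧ Valued.v (E 1) ≤ Valued.v ϖ ^ ℓ ∧ Valued.v (E 0) ≤ Valued.v ϖ ^ ℓ) ∧
      Valued.v (E 1 - E 2) ≤ Valued.v ϖ ^ (ℓ + ρ) ∧ Valued.v (E 0 - E 1) ≤ Valued.v ϖ ^ (ℓ + ρ + s) ∧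
        (Valued.v (E 0 - E 1) ≤ Valued.v ϖ ^ (ℓ + 2 * ρ + s) ∧ Valued.v (E 0 - E 2) * Valued.v ϖ ^ s ≤ Valued.v ϖ ^ (ℓ + 2 * ρ + s)) := by
  have he12 : Valued.v (E 1 - E 2) = Valued.v ϖ ^ (2 * n₁) := by rw [he2, sub_zero, he1]
  have he02 : Valued.v (E 0 - E 2) = Valued.v ϖ ^ (2 * n₂) := by rw [he2, sub_zero, he0]
  have he01 : Valued.v (E 0 - E 1) ≤ Valued.v ϖ ^ X := by rw [Valuation.map_sub_swap]; exact he10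
  refine ⟨⟨?_, ?_, ?_⟩, ?_, ?_, ?_, ?_⟩
  · rw [he2, map_zero]; exact zero_le
  · rw [he1]; exact pow_le_pow_right_of_le_one' hϖ1 h1
  · rw [he0]; exact pow_le_pow_right_of_le_one' hϖ1 h0
  · rw [he12]; exact pow_le_pow_right_of_le_one' hϖ1 h12
  · exact he01.trans (pow_le_pow_right_of_le_one' hϖ1 h10)
  · exact he01.trans (pow_le_pow_right_of_le_one' hϖ1 hc1)
  · rw [he02, ← pow_add]; exact pow_le_pow_right_of_le_one' hϖ1 (by omega)

omit [Fintype 𝓀[K]] [CompleteSpace K] in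
/-- The truncation read off the G3 label condition: `|E₀ − E₂|·|ϖ|^s ≤ |ϖ|^{ℓ+2ρ+s}` with `|E₀ − E₂| = |ϖ|^{2n₂}` is `ℓ + 2ρ ≤ 2n₂`. [cite: Kottwitz1986BaseChangeUnits, §1 pp. 240–241] -/
theorem le_of_sqLabel_G3_cond {ϖ : K} (hϖ0 : 0 < Valued.v ϖ) (hϖlt : Valued.v ϖ < 1) {E : Fin 3 → K} {n₂ ℓ ρ s : ℕ}
    (he0 : Valued.v (E 0) = Valued.v ϖ ^ (2 * n₂)) (he2 : E 2 = 0)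
    (h : Valued.v (E 0 - E 2) * Valued.v ϖ ^ s ≤ Valued.v ϖ ^ (ℓ + 2 * ρ + s)) : ℓ + 2 * ρ ≤ 2 * n₂ := by
  rw [he2, sub_zero, he0, ← pow_add] at h
  have := le_of_pow_le_pow hϖ0 hϖlt h
  omega

omit [Fintype 𝓀[K]] [CompleteSpace K] in
/-- **THE H LABEL CONDITION FROM EXPONENT INEQUALITIES** (square-token letters). [cite: Kottwitz1986BaseChangeUnits, §1 pp. 240–241] -/
theorem sqLabel_H_cond_of {ϖ : K} (hϖ1 : Valued.v ϖ ≤ 1) {E : Fin 3 → K} {n₁ n₂ X ℓ ρ : ℕ}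
    (he0 : Valued.v (E 0) = Valued.v ϖ ^ (2 * n₂)) (he1 : Valued.v (E 1) = Valued.v ϖ ^ (2 * n₁)) (he2 : E 2 = 0)
    (he10 : Valued.v (E 1 - E 0) ≤ Valued.v ϖ ^ X)
    (h0 : ℓ ≤ 2 * n₂) (h1 : ℓ ≤ 2 * n₁) (h10 : ℓ + ρ ≤ X) (h21 : ℓ + ρ ≤ 2 * n₁) (hc1 : ℓ + 2 * ρ ≤ 2 * n₁) (hc2 : ℓ + 2 * ρ ≤ 2 * n₂) :
    (Valued.v (E 0) ≤ Valued.v ϖ ^ ℓ ∧ Valued.v (E 1) ≤ Valued.v ϖ ^ ℓ ∧ Valued.v (E 2) ≤ Valued.v ϖ ^ ℓ) ∧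
      Valued.v (E 1 - E 0) ≤ Valued.v ϖ ^ (ℓ + ρ) ∧ Valued.v (E 2 - E 1) ≤ Valued.v ϖ ^ (ℓ + ρ) ∧
        (Valued.v (E 2 - E 1) ≤ Valued.v ϖ ^ (ℓ + 2 * ρ) ∧ Valued.v (E 2 - E 0) ≤ Valued.v ϖ ^ (ℓ + 2 * ρ)) := by
  have he21 : Valued.v (E 2 - E 1) = Valued.v ϖ ^ (2 * n₁) := by rw [he2, zero_sub, Valuation.map_neg, he1]
  have he20 : Valued.v (E 2 - E 0) = Valued.v ϖ ^ (2 * n₂) := by rw [he2, zero_sub, Valuation.map_neg, he0]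
  refine ⟨⟨?_, ?_, ?_⟩, ?_, ?_, ?_, ?_⟩
  · rw [he0]; exact pow_le_pow_right_of_le_one' hϖ1 h0
  · rw [he1]; exact pow_le_pow_right_of_le_one' hϖ1 h1
  · rw [he2, map_zero]; exact zero_le
  · exact he10.trans (pow_le_pow_right_of_le_one' hϖ1 h10)
  · rw [he21]; exact pow_le_pow_right_of_le_one' hϖ1 h21
  · rw [he21]; exact pow_le_pow_right_of_le_one' hϖ1 hc1
  · rw [he20]; exact pow_le_pow_right_of_le_one' hϖ1 hc2

omit [CompleteSpace K] in
/-- **THE CORE-HANGING STRATUM IS EMPTY OFF ITS WINDOWS**: neither `2ρ ≤ min nᵢ` nor the equilateral hanging window ⇒ `stratum(2ρ,2ρ,2ρ) = ∅`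
(★ `finsum_stabiliserWeight_hasAxis_H` vanishes). [cite: Kottwitz1986BaseChangeUnits, §1 pp. 240–241] -/
theorem stratum_H_eq_empty_of_no_window (hD : IsRamifiedQuadraticDatum σ ϖ d t) (h2 : Valued.v (2 : K) < 1) (hE : IsElementDatum σ ϖ N₀ α β n₁ n₂ n₃)
    (hN₀ : d ≤ N₀) (hT : (T : Matrix (Fin 3) (Fin 3) K) = Matrix.diagonal ![α, β, 1]) (ρ : ℕ) (hρ : 1 ≤ ρ)
    (hnot : ¬ 2 * ρ ≤ min n₁ (min n₂ n₃)) (hnof : ¬ (n₁ = n₂ ∧ n₂ = n₃ ∧ n₁ < 2 * ρ ∧ 2 * ρ - n₁ ≤ n₁ - d + 1)) :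
    stratum σ ϖ T ![2 * ρ, 2 * ρ, 2 * ρ] = ∅ := by
  refine stratum_eq_empty_of_finsum_stabiliserWeight_eq_zero hD hE hT _ ?_
  rw [finsum_stabiliserWeight_hasAxis_H hD h2 hE hN₀ hT ρ hρ, if_neg hnot, if_neg hnof, add_zero]

/-! ## §2  The apex-3 glued cell G3 -/

/-- **GLUED CELL G3 `(2ρ+s, 2ρ+s, 2ρ)` OF THE SQUARE LABEL IN BOX-SUM CURRENCY** (★ p856906's `hG3` spelling, `n₁`-based; glue witness `f₂` of foot 2 with ★'s guard in the
`(β−α)∕(1−α)` form): the tube untouched, the glue foot cut by `2ρ + (d%2 + 2d) ≤ 2n₁ + 1`; proof via ★ p859941's G3 socket off the class cut (tube: `2n₂ ≥ ℓ+2ρ`; foot: the type is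
`n₁ = n₂ < n₃` and the third letter is strictly deeper than `2n₂ + s`) and PART 2's rotated emptiness. [cite: Kottwitz1986BaseChangeUnits, §1 pp. 240–241]
[cite: Rogawski1990, §4.9 Prop. 4.9.1 (a) p. 55; §4.10 p. 58] [cite: LanglandsShelstad1987, §3] -/
theorem cell_G3 (hD : IsRamifiedQuadraticDatum σ ϖ d t) (h2 : Valued.v (2 : K) < 1) (hE : IsElementDatum σ ϖ N₀ α β n₁ n₂ n₃) (hN₀ : d ≤ N₀)
    (hT : (T : Matrix (Fin 3) (Fin 3) K) = Matrix.diagonal ![α, β, 1]) (hfence : 2 * d ≤ n₁ + 1 ∧ 2 * d ≤ n₂ + 1 ∧ 2 * d ≤ n₃ + 1)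
    {ℓ : ℕ} (hℓ : ℓ + 1 = d % 2 + 2 * d) (ρ s : ℕ) (hρ : 1 ≤ ρ) (hs : 1 ≤ s) (i : Fin 3) (f₂ : K) (hf₂ : σ f₂ = f₂)
    (hglue : 2 ∣ s → n₂ = n₁ → n₃ = n₂ + s → n₂ < 2 * ρ → 2 * ρ - n₂ ≤ n₂ - d + 1 → Valued.v (f₂ + (β - α) / (1 - α)) ≤ Valued.v ϖ ^ (2 * ρ + s - n₂)) :
    ∑ᶠ M ∈ {M | M ∈ stratum σ ϖ T ![2 * ρ + s, 2 * ρ + s, 2 * ρ] ∧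
        LatticeInLevel ϖ ℓ (Matrix.diagonal ![(α - 1) * (α - 1), (β - 1) * (β - 1), 0]) M}, (kappaCount σ ϖ 0 i M : ℚ) * stabiliserWeight σ M =
      (if 2 ∣ s ∧ 2 * ρ ≤ min n₁ n₂ ∧ 2 * ρ + s ≤ n₃ then
          (![0, 0, (normSign σ (-1 : K) : ℚ) * (Fintype.card 𝓀[K] : ℚ) ^ (2 * ρ + s / 2 - 1) *
              ((if 2 * d ≤ s then (Fintype.card 𝓀[K] : ℚ) - 1 else 0) - (if s + 2 = 2 * d then 1 else 0))] : Fin 3 → ℚ) i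
        else 0) +
      (if 2 ∣ s ∧ n₁ = n₂ ∧ n₃ = n₁ + s ∧ n₁ < 2 * ρ ∧ 2 * ρ - n₁ ≤ n₁ - d + 1 ∧ 2 * ρ + (d % 2 + 2 * d) ≤ 2 * n₁ + 1 then
          (![if d ≤ (2 * ρ - n₁ + 1) / 2 then (normSign σ f₂ : ℚ) else 0,
             if d ≤ (2 * ρ - n₁ + 1) / 2 then (normSign σ (-1 : K) : ℚ) * normSign σ f₂ * normSign σ (1 + f₂) else 0,
             if 2 * d ≤ s + 2 * ((2 * ρ - n₁ + 1) / 2) then (normSign σ (-1 : K) : ℚ) * normSign σ (1 + f₂) else 0] : Fin 3 → ℚ) i *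
            (Fintype.card 𝓀[K] : ℚ) ^ (2 * ρ + s / 2 - (2 * ρ - n₁ + 1) / 2)
        else 0) := by
  obtain ⟨-, -, hϖ, -, -, -, h2t⟩ := id hD
  obtain ⟨-, -, -, -, -, h₁, h₂, h₃, -, -, -⟩ := id hE
  have hϖ1 : Valued.v ϖ ≤ 1 := by rw [hϖ, ← WithZero.exp_zero, WithZero.exp_le_exp]; norm_num
  have hϖ0 : 0 < Valued.v ϖ := by rw [hϖ]; exact WithZero.exp_pos
  have hϖlt : Valued.v ϖ < 1 := by rw [hϖ, ← WithZero.exp_zero, WithZero.exp_lt_exp]; norm_num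
  obtain ⟨hp1, hp2, hp3⟩ := depth_mod_two_eq_of_isElementDatum hD hE hN₀
  have hiso := isoceles_of_isElementDatum hD hE
  obtain ⟨he0, he1, he2⟩ := sqToken_entries (α := α) (β := β) h₁ h₂
  obtain ⟨he20, he21, he10⟩ := sqToken_differences_le (α := α) (β := β) hϖ1 h₁ h₂
  -- `|2| ≤ |ϖ|` (the type-C letter)
  have ht1 : 1 ≤ t := by
    by_contra ht
    have ht0 : t = 0 := by omega
    rw [h2t, ht0, pow_zero] at h2
    exact absurd h2 (lt_irrefl 1)
  have h2ϖ : Valued.v (2 : K) ≤ Valued.v ϖ := by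
    rw [h2t]
    calc Valued.v ϖ ^ t ≤ Valued.v ϖ ^ 1 := pow_le_pow_right_of_le_one' hϖ1 ht1
      _ = Valued.v ϖ := pow_one _
  have hC : n₁ = n₂ → n₂ < n₃ →
      Valued.v ((![(α - 1) * (α - 1), (β - 1) * (β - 1), 0] : Fin 3 → K) 1 - (![(α - 1) * (α - 1), (β - 1) * (β - 1), 0] : Fin 3 → K) 0) ≤
        Valued.v ϖ ^ (n₂ + n₃ + 1) := fun h12 h23 => sqToken_third_le_typeC hϖ1 h2ϖ h₂ h₃ (by omega)
  by_cases hwin : (2 ∣ s ∧ 2 * ρ ≤ min n₂ n₁ ∧ 2 * ρ + s ≤ n₃) ∨ (2 ∣ s ∧ n₂ = n₁ ∧ n₃ = n₂ + s ∧ n₂ < 2 * ρ ∧ 2 * ρ - n₂ ≤ n₂ - d + 1)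
  · have hcut : ¬ (Valued.v ((![(α - 1) * (α - 1), (β - 1) * (β - 1), 0] : Fin 3 → K) 0 - (![(α - 1) * (α - 1), (β - 1) * (β - 1), 0] : Fin 3 → K) 1) =
          Valued.v ((![(α - 1) * (α - 1), (β - 1) * (β - 1), 0] : Fin 3 → K) 0 - (![(α - 1) * (α - 1), (β - 1) * (β - 1), 0] : Fin 3 → K) 2) *
            Valued.v ϖ ^ s ∧
        Valued.v ϖ ^ (ℓ + 2 * ρ + s) <
          Valued.v ((![(α - 1) * (α - 1), (β - 1) * (β - 1), 0] : Fin 3 → K) 0 - (![(α - 1) * (α - 1), (β - 1) * (β - 1), 0] : Fin 3 → K) 1)) := by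
      rintro ⟨hEq, hLt⟩
      rw [he2, sub_zero, he0, ← pow_add] at hEq
      rw [Valuation.map_sub_swap] at hEq hLt
      rw [hEq] at hLt
      have hc : 2 * n₂ + s < ℓ + 2 * ρ + s := lt_of_pow_lt_pow hϖ1 hLt
      rcases hwin with ⟨-, hmin, hn3⟩ | ⟨-, h21, h3s, hlt, -⟩
      · have : 2 * ρ ≤ n₂ := le_trans hmin (min_le_left _ _)
        omega
      · have hle' : Valued.v ϖ ^ (2 * n₂ + s) ≤ Valued.v ϖ ^ (n₂ + n₃ + 1) := by
          rw [← hEq]; exact hC h21.symm (by omega)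
        have hge := le_of_pow_le_pow hϖ0 hϖlt hle'
        omega
    rw [finsum_kappaCount_mul_stabiliserWeight_stratum_G3_sep_latticeInLevel_of_not_cut hD h2 hE hN₀ hT ρ s hρ hs i f₂ hf₂ hglue ℓ _ hcut]
    by_cases hL : (Valued.v ((![(α - 1) * (α - 1), (β - 1) * (β - 1), 0] : Fin 3 → K) 2) ≤ Valued.v ϖ ^ ℓ ∧
          Valued.v ((![(α - 1) * (α - 1), (β - 1) * (β - 1), 0] : Fin 3 → K) 1) ≤ Valued.v ϖ ^ ℓ ∧
          Valued.v ((![(α - 1) * (α - 1), (β - 1) * (β - 1), 0] : Fin 3 → K) 0) ≤ Valued.v ϖ ^ ℓ) ∧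
        Valued.v ((![(α - 1) * (α - 1), (β - 1) * (β - 1), 0] : Fin 3 → K) 1 - (![(α - 1) * (α - 1), (β - 1) * (β - 1), 0] : Fin 3 → K) 2) ≤
            Valued.v ϖ ^ (ℓ + ρ) ∧
          Valued.v ((![(α - 1) * (α - 1), (β - 1) * (β - 1), 0] : Fin 3 → K) 0 - (![(α - 1) * (α - 1), (β - 1) * (β - 1), 0] : Fin 3 → K) 1) ≤
            Valued.v ϖ ^ (ℓ + ρ + s) ∧
          (Valued.v ((![(α - 1) * (α - 1), (β - 1) * (β - 1), 0] : Fin 3 → K) 0 - (![(α - 1) * (α - 1), (β - 1) * (β - 1), 0] : Fin 3 → K) 1) ≤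
              Valued.v ϖ ^ (ℓ + 2 * ρ + s) ∧
            Valued.v ((![(α - 1) * (α - 1), (β - 1) * (β - 1), 0] : Fin 3 → K) 0 - (![(α - 1) * (α - 1), (β - 1) * (β - 1), 0] : Fin 3 → K) 2) *
                Valued.v ϖ ^ s ≤ Valued.v ϖ ^ (ℓ + 2 * ρ + s))
    · have htr : ℓ + 2 * ρ ≤ 2 * n₂ := le_of_sqLabel_G3_cond hϖ0 hϖlt he0 he2 hL.2.2.2.2
      rw [if_pos hL, min_comm n₂ n₁]
      congr 1
      by_cases hfoot : 2 ∣ s ∧ n₂ = n₁ ∧ n₃ = n₂ + s ∧ n₂ < 2 * ρ ∧ 2 * ρ - n₂ ≤ n₂ - d + 1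
      · obtain ⟨hs2, h21, h3s, hlt, hle⟩ := hfoot
        have h6 : 2 ∣ s ∧ n₁ = n₂ ∧ n₃ = n₁ + s ∧ n₁ < 2 * ρ ∧ 2 * ρ - n₁ ≤ n₁ - d + 1 ∧ 2 * ρ + (d % 2 + 2 * d) ≤ 2 * n₁ + 1 :=
          ⟨hs2, h21.symm, by omega, by omega, by omega, by omega⟩
        rw [if_pos ⟨hs2, h21, h3s, hlt, hle⟩, if_pos h6, h21]
      · have h6 : ¬ (2 ∣ s ∧ n₁ = n₂ ∧ n₃ = n₁ + s ∧ n₁ < 2 * ρ ∧ 2 * ρ - n₁ ≤ n₁ - d + 1 ∧ 2 * ρ + (d % 2 + 2 * d) ≤ 2 * n₁ + 1) :=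
          fun h => hfoot ⟨h.1, h.2.1.symm, by omega, by omega, by omega⟩
        rw [if_neg hfoot, if_neg h6]
    · rw [if_neg hL]
      symm
      rcases hwin with ⟨hs2, hmin, hn3⟩ | ⟨hs2, h21, h3s, hlt, hle⟩
      · have h2ρ : 2 * ρ ≤ n₂ := le_trans hmin (min_le_left _ _)
        have h2ρ' : 2 * ρ ≤ n₁ := le_trans hmin (min_le_right _ _)
        have hnofoot : ¬ (2 ∣ s ∧ n₁ = n₂ ∧ n₃ = n₁ + s ∧ n₁ < 2 * ρ ∧ 2 * ρ - n₁ ≤ n₁ - d + 1 ∧ 2 * ρ + (d % 2 + 2 * d) ≤ 2 * n₁ + 1) :=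
          fun h => absurd h.2.2.2.1 (not_lt.2 h2ρ')
        have h3 : 2 ∣ s ∧ 2 * ρ ≤ min n₁ n₂ ∧ 2 * ρ + s ≤ n₃ := ⟨hs2, by rw [min_comm]; exact hmin, hn3⟩
        rw [if_pos h3, if_neg hnofoot, add_zero]
        by_cases hnz : i = 2 ∧ (2 * d ≤ s ∨ s + 2 = 2 * d)
        · obtain ⟨-, hsd⟩ := hnz
          refine absurd ?_ hL
          by_cases hCt : n₁ = n₂ ∧ n₂ < n₃
          · exact sqLabel_G3_cond_of hϖ1 he0 he1 he2 (hC hCt.1 hCt.2) (by omega) (by omega) (by omega) (by omega) (by omega) (by omega)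
          · have hn3 : n₃ ≤ min n₁ n₂ := by
              rcases hiso with ⟨h12, h13⟩ | ⟨h13, h12⟩ | ⟨h23, h21⟩
              · have hn : ¬ n₂ < n₃ := fun h => hCt ⟨h12, h⟩
                exact le_min (by omega) (by omega)
              · exact le_min (by omega) (by omega)
              · exact le_min (by omega) (by omega)
            have hmle : min n₁ n₂ ≤ n₁ := min_le_left _ _
            have hmle' : min n₁ n₂ ≤ n₂ := min_le_right _ _
            exact sqLabel_G3_cond_of hϖ1 he0 he1 he2 he10 (by omega) (by omega) (by omega) (by omega) (by omega) (by omega)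
        · fin_cases i
          · rfl
          · rfl
          · have hnd : ¬ (2 * d ≤ s) := fun h => hnz ⟨rfl, Or.inl h⟩
            have hne : ¬ (s + 2 = 2 * d) := fun h => hnz ⟨rfl, Or.inr h⟩
            simp only [Fin.reduceFinMk, Matrix.cons_val_two, Matrix.tail_cons, Matrix.head_cons, if_neg hnd, if_neg hne, sub_zero, mul_zero]
      · have hnotube : ¬ (2 ∣ s ∧ 2 * ρ ≤ min n₁ n₂ ∧ 2 * ρ + s ≤ n₃) :=
          fun h => absurd (le_trans h.2.1 (min_le_right _ _)) (not_le.2 hlt)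
        have h6 : ¬ (2 ∣ s ∧ n₁ = n₂ ∧ n₃ = n₁ + s ∧ n₁ < 2 * ρ ∧ 2 * ρ - n₁ ≤ n₁ - d + 1 ∧ 2 * ρ + (d % 2 + 2 * d) ≤ 2 * n₁ + 1) := by
          rintro ⟨-, -, -, -, -, htr⟩
          exact hL (sqLabel_G3_cond_of hϖ1 he0 he1 he2 (hC h21.symm (by omega)) (by omega) (by omega) (by omega) (by omega) (by omega) (by omega))
        rw [if_neg hnotube, zero_add, if_neg h6]
  · have hnot : ¬ (2 ∣ s ∧ 2 * ρ ≤ min n₂ n₁ ∧ 2 * ρ + s ≤ n₃) := fun h => hwin (Or.inl h)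
    have hnof : ¬ (2 ∣ s ∧ n₂ = n₁ ∧ n₃ = n₂ + s ∧ n₂ < 2 * ρ ∧ 2 * ρ - n₂ ≤ n₂ - d + 1) := fun h => hwin (Or.inr h)
    have hnot' : ¬ (2 ∣ s ∧ 2 * ρ ≤ min n₁ n₂ ∧ 2 * ρ + s ≤ n₃) := fun h => hnot ⟨h.1, by rw [min_comm]; exact h.2.1, h.2.2⟩
    have h6 : ¬ (2 ∣ s ∧ n₁ = n₂ ∧ n₃ = n₁ + s ∧ n₁ < 2 * ρ ∧ 2 * ρ - n₁ ≤ n₁ - d + 1 ∧ 2 * ρ + (d % 2 + 2 * d) ≤ 2 * n₁ + 1) :=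
      fun h => hnof ⟨h.1, h.2.1.symm, by omega, by omega, by omega⟩
    rw [cellAny_G3_of_no_window hD h2 hE hN₀ hT ρ s hρ hs i ℓ _ hnot hnof, if_neg hnot', zero_add, if_neg h6]

/-! ## §3  The core-hanging cell H -/

/-- **CORE-HANGING CELL H `(2ρ, 2ρ, 2ρ)` OF THE SQUARE LABEL IN BOX-SUM CURRENCY** (glue witness `f₀` with ★ κH's guard): ★ p856906's `hH` value — the equilateral hanging
letters `(ω(−(1+f₀)), ω(f₀)ω(−(1+f₀)), ω(f₀))ᵢ·q^{2ρ−⌈(2ρ−n)∕2⌉}` behind `n₁ = n₂ = n₃ ∧ n₁ < 2ρ ∧ 2ρ − n₁ ≤ n₁ − d + 1 ∧ d ≤ ⌈(2ρ−n₁)∕2⌉` — CUT by `2ρ + (d%2 + 2d) ≤ 2n₁ + 1`: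
tube window ⇒ ★ NotCut H (vacuous), κ-null; equilateral foot ⇒ ★ p859864 (the genuine hanging cells are EMPTY — disjoint balls); no window ⇒ EMPTY stratum.
[cite: Kottwitz1986BaseChangeUnits, §1 pp. 240–241] [cite: Rogawski1990, §4.9 Prop. 4.9.1 (a) p. 55; §4.10 p. 58] [cite: LanglandsShelstad1987, §3] -/
theorem cell_H (hD : IsRamifiedQuadraticDatum σ ϖ d t) (h2 : Valued.v (2 : K) < 1) (hE : IsElementDatum σ ϖ N₀ α β n₁ n₂ n₃) (hN₀ : d ≤ N₀)
    (hT : (T : Matrix (Fin 3) (Fin 3) K) = Matrix.diagonal ![α, β, 1]) (hfence : 2 * d ≤ n₁ + 1 ∧ 2 * d ≤ n₂ + 1 ∧ 2 * d ≤ n₃ + 1)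
    {ℓ : ℕ} (hℓ : ℓ + 1 = d % 2 + 2 * d) (ρ : ℕ) (hρ : 1 ≤ ρ) (i : Fin 3) (f₀ : K) (hσf₀ : σ f₀ = f₀)
    (hf₀ : n₁ = n₂ → n₂ = n₃ → n₁ < 2 * ρ → 2 * ρ - n₁ ≤ n₁ - d + 1 → Valued.v (f₀ + (β - 1) / (α - 1)) ≤ Valued.v ϖ ^ (2 * ρ - n₁)) :
    ∑ᶠ M ∈ {M | M ∈ stratum σ ϖ T ![2 * ρ, 2 * ρ, 2 * ρ] ∧
        LatticeInLevel ϖ ℓ (Matrix.diagonal ![(α - 1) * (α - 1), (β - 1) * (β - 1), 0]) M}, (kappaCount σ ϖ 0 i M : ℚ) * stabiliserWeight σ M =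
      if n₁ = n₂ ∧ n₂ = n₃ ∧ n₁ < 2 * ρ ∧ 2 * ρ - n₁ ≤ n₁ - d + 1 ∧ d ≤ (2 * ρ - n₁ + 1) / 2 ∧ 2 * ρ + (d % 2 + 2 * d) ≤ 2 * n₁ + 1 then
        (((![normSign σ (-(1 + f₀)), normSign σ f₀ * normSign σ (-(1 + f₀)), normSign σ f₀] : Fin 3 → ℤ) i : ℤ) : ℚ) *
          (Fintype.card 𝓀[K] : ℚ) ^ (2 * ρ - (2 * ρ - n₁ + 1) / 2)
      else 0 := by
  obtain ⟨-, -, hϖ, -, -, -, -⟩ := id hD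
  obtain ⟨-, -, -, -, -, h₁, h₂, -, -, -, -⟩ := id hE
  have hϖ1 : Valued.v ϖ ≤ 1 := by rw [hϖ, ← WithZero.exp_zero, WithZero.exp_le_exp]; norm_num
  have hϖ0 : 0 < Valued.v ϖ := by rw [hϖ]; exact WithZero.exp_pos
  have hϖlt : Valued.v ϖ < 1 := by rw [hϖ, ← WithZero.exp_zero, WithZero.exp_lt_exp]; norm_num
  obtain ⟨hp1, hp2, hp3⟩ := depth_mod_two_eq_of_isElementDatum hD hE hN₀
  obtain ⟨he0, he1, he2⟩ := sqToken_entries (α := α) (β := β) h₁ h₂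
  obtain ⟨he20, he21, he10⟩ := sqToken_differences_le (α := α) (β := β) hϖ1 h₁ h₂
  by_cases htube : 2 * ρ ≤ min n₁ (min n₂ n₃)
  · -- tube window: vacuous, and the ★ κH value is `0` there
    have h2ρ1 : 2 * ρ ≤ n₁ := le_trans htube (min_le_left _ _)
    have h2ρ2 : 2 * ρ ≤ n₂ := le_trans htube ((min_le_right _ _).trans (min_le_left _ _))
    have hcut : ¬ (Valued.v ((![(α - 1) * (α - 1), (β - 1) * (β - 1), 0] : Fin 3 → K) 2 - (![(α - 1) * (α - 1), (β - 1) * (β - 1), 0] : Fin 3 → K) 1) =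
          Valued.v ((![(α - 1) * (α - 1), (β - 1) * (β - 1), 0] : Fin 3 → K) 2 - (![(α - 1) * (α - 1), (β - 1) * (β - 1), 0] : Fin 3 → K) 0) ∧
        Valued.v ϖ ^ (ℓ + 2 * ρ) <
          Valued.v ((![(α - 1) * (α - 1), (β - 1) * (β - 1), 0] : Fin 3 → K) 2 - (![(α - 1) * (α - 1), (β - 1) * (β - 1), 0] : Fin 3 → K) 1)) := by
      rintro ⟨-, hLt⟩
      rw [he21] at hLt
      have hc : 2 * n₁ < ℓ + 2 * ρ := lt_of_pow_lt_pow hϖ1 hLt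
      omega
    have hnofoot : ¬ (n₁ = n₂ ∧ n₂ = n₃ ∧ n₁ < 2 * ρ ∧ 2 * ρ - n₁ ≤ n₁ - d + 1 ∧ d ≤ (2 * ρ - n₁ + 1) / 2) := fun h => absurd h.2.2.1 (not_lt.2 h2ρ1)
    have h6 : ¬ (n₁ = n₂ ∧ n₂ = n₃ ∧ n₁ < 2 * ρ ∧ 2 * ρ - n₁ ≤ n₁ - d + 1 ∧ d ≤ (2 * ρ - n₁ + 1) / 2 ∧ 2 * ρ + (d % 2 + 2 * d) ≤ 2 * n₁ + 1) :=
      fun h => absurd h.2.2.1 (not_lt.2 h2ρ1)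
    rw [finsum_kappaCount_mul_stabiliserWeight_stratum_H_sep_latticeInLevel_of_not_cut hD h2 hE hN₀ hT ρ hρ i f₀ hσf₀ hf₀ ℓ _ hcut, if_neg hnofoot, if_neg h6]
    split_ifs <;> rfl
  · by_cases hfoot : n₁ = n₂ ∧ n₂ = n₃ ∧ n₁ < 2 * ρ ∧ 2 * ρ - n₁ ≤ n₁ - d + 1
    · -- equilateral foot: ★ p859864 K6
      obtain ⟨h12, h23, hm, hle⟩ := hfoot
      have hρm : ρ ≤ n₁ := by omega
      rw [finsum_kappaCount_mul_stabiliserWeight_stratum_H_sep_sqToken_foot hD h2 hE hN₀ hT ρ hρ h12 (h12.trans h23) hρm hm i f₀ hσf₀ hf₀ ℓ]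
      have hv0 : Valued.v ((α - 1) * (α - 1)) = Valued.v ϖ ^ (2 * n₂) := by rw [map_mul, h₂, ← pow_add, two_mul]
      have hv1 : Valued.v ((β - 1) * (β - 1)) = Valued.v ϖ ^ (2 * n₁) := by rw [map_mul, h₁, ← pow_add, two_mul]
      have hv10 : Valued.v ((β - 1) * (β - 1) - (α - 1) * (α - 1)) ≤ Valued.v ϖ ^ (2 * min n₁ n₂) := by
        simpa only [Matrix.cons_val_zero, Matrix.cons_val_one, Matrix.head_cons] using he10
      by_cases htr : 2 * ρ + (d % 2 + 2 * d) ≤ 2 * n₁ + 1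
      · have hreads : ((Valued.v ((α - 1) * (α - 1)) ≤ Valued.v ϖ ^ ℓ ∧ Valued.v ((β - 1) * (β - 1)) ≤ Valued.v ϖ ^ ℓ ∧ Valued.v (0 : K) ≤ Valued.v ϖ ^ ℓ) ∧
            Valued.v ((β - 1) * (β - 1) - (α - 1) * (α - 1)) ≤ Valued.v ϖ ^ (ℓ + ρ)) ∧ ℓ + ρ ≤ 2 * n₁ := by
          refine ⟨⟨⟨?_, ?_, ?_⟩, ?_⟩, by omega⟩
          · rw [hv0]; exact pow_le_pow_right_of_le_one' hϖ1 (by omega)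
          · rw [hv1]; exact pow_le_pow_right_of_le_one' hϖ1 (by omega)
          · rw [map_zero]; exact zero_le
          · have hmn : min n₁ n₂ = n₁ := min_eq_left (by omega)
            rw [hmn] at hv10
            exact hv10.trans (pow_le_pow_right_of_le_one' hϖ1 (by omega))
        have hvac : ℓ + 2 * ρ ≤ 2 * n₁ := by omega
        rw [if_pos hreads, if_pos hvac]
        by_cases hd' : d ≤ (2 * ρ - n₁ + 1) / 2
        · have h5 : n₁ = n₂ ∧ n₂ = n₃ ∧ n₁ < 2 * ρ ∧ 2 * ρ - n₁ ≤ n₁ - d + 1 ∧ d ≤ (2 * ρ - n₁ + 1) / 2 := ⟨h12, h23, hm, hle, hd'⟩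
          have h6 : n₁ = n₂ ∧ n₂ = n₃ ∧ n₁ < 2 * ρ ∧ 2 * ρ - n₁ ≤ n₁ - d + 1 ∧ d ≤ (2 * ρ - n₁ + 1) / 2 ∧ 2 * ρ + (d % 2 + 2 * d) ≤ 2 * n₁ + 1 :=
            ⟨h12, h23, hm, hle, hd', htr⟩
          rw [if_pos h5, if_pos h6]
        · have h5 : ¬ (n₁ = n₂ ∧ n₂ = n₃ ∧ n₁ < 2 * ρ ∧ 2 * ρ - n₁ ≤ n₁ - d + 1 ∧ d ≤ (2 * ρ - n₁ + 1) / 2) := fun h => hd' h.2.2.2.2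
          have h6 : ¬ (n₁ = n₂ ∧ n₂ = n₃ ∧ n₁ < 2 * ρ ∧ 2 * ρ - n₁ ≤ n₁ - d + 1 ∧ d ≤ (2 * ρ - n₁ + 1) / 2 ∧ 2 * ρ + (d % 2 + 2 * d) ≤ 2 * n₁ + 1) :=
            fun h => hd' h.2.2.2.2.1
          rw [if_neg h5, if_neg h6]
      · have h6 : ¬ (n₁ = n₂ ∧ n₂ = n₃ ∧ n₁ < 2 * ρ ∧ 2 * ρ - n₁ ≤ n₁ - d + 1 ∧ d ≤ (2 * ρ - n₁ + 1) / 2 ∧ 2 * ρ + (d % 2 + 2 * d) ≤ 2 * n₁ + 1) :=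
          fun h => htr h.2.2.2.2.2
        rw [if_neg h6]
        split_ifs <;> first | rfl | omega
    · -- no window: the stratum is empty
      have h6 : ¬ (n₁ = n₂ ∧ n₂ = n₃ ∧ n₁ < 2 * ρ ∧ 2 * ρ - n₁ ≤ n₁ - d + 1 ∧ d ≤ (2 * ρ - n₁ + 1) / 2 ∧ 2 * ρ + (d % 2 + 2 * d) ≤ 2 * n₁ + 1) :=
        fun h => hfoot ⟨h.1, h.2.1, h.2.2.1, h.2.2.2.1⟩
      rw [stratum_H_eq_empty_of_no_window hD h2 hE hN₀ hT ρ hρ htube hfoot, if_neg h6]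
      simp

end Summit.HodgeConjecture.HodgeConjecture.Cruxes.H413.F0P3cDyRamSqLabelledCellsCorner

end
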